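import Mathlib
import Summits.ValiantsHypothesis.ValiantsHypothesis.Theorems.TriangularDimersDivisionEasy.Negative.LowerBound

/-!
# `TriangularDimersDivisionEasy` — negative lemma: the crux is FALSE WITHOUT THE DIVISION

Crux `stmt-ValiantsHypothesis-5067` (`Theses.DivisionGap.TriangularDimersDivisionEasy`, route
DivisionGap).  Standing disprover (cdisprove gen 1); closes the near-miss §E of
`Cruxes/TriangularDimersDivisionEasy/Disproof.lean`.

"Monotone-easy without division" — the crux with the free factor `h` frozen to `1`, i.e. "`D_n` has
quasi-polynomial MONOTONE complexity", `∃ c ∀ n, L₊(D_n) ≤ 2^((log₂ n + c)^c)` (stated inline; the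
Cruxes workfile names it `MonotoneEasyWithoutDivision`) — is false by `monotone_lower_bound`
(Valiant's `2^{Ω(n)}` bound): `not_monotoneEasyWithoutDivision`.  Hence the division — some `h` of super-quasi-polynomial
monotone usefulness — is exactly what any proof of `TriangularDimersDivisionEasy` has to produce; the
statement is not refutable by the monotone technology that proves this file (see the Disproof docblock
for why no `{+,×,÷}` lower-bound technique is presently available).
[cite: Valiant1980, §3 Thm 1]
-/

namespace Summit.ValiantsHypothesis.ValiantsHypothesis.Theorems.TriangularDimersDivisionEasy.Negative

open Literature.Computability.AlgebraicComplexity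
open MvPolynomial
open scoped BigOperators NNReal

set_option linter.dupNamespace false

noncomputable section

/-- The `h = 1` instance of the crux's clause is literally the clause "`L₊(D_n) ≤ 2^((log₂ n + c)^c)`" refuted below.
[folklore] -/
theorem clause_at_one_iff (c n : ℕ) :
    complexity (triPM n * 1) + complexity (1 : MvPolynomial (Var n) ℝ≥0) ≤ bound c n ↔
      complexity (triPM n) ≤ bound c n := by
  simp

/-! ## Elementary growth lemmas (for a general constant `T`, instantiated at `Tfib = 6^44`) -/

/-- Two binomial terms: `m^(k+1) + (k+1)·m^k ≤ (m+1)^(k+1)`. [folklore] -/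
theorem pow_add_mul_pow_le (m : ℕ) : ∀ k : ℕ, m ^ (k + 1) + (k + 1) * m ^ k ≤ (m + 1) ^ (k + 1) := by
  intro k
  induction k with
  | zero => simp
  | succ k ih =>
    calc m ^ (k + 1 + 1) + (k + 1 + 1) * m ^ (k + 1)
        ≤ m ^ (k + 1 + 1) + (k + 1 + 1) * m ^ (k + 1) + (k + 1) * m ^ k := Nat.le_add_right _ _
      _ = (m + 1) * (m ^ (k + 1) + (k + 1) * m ^ k) := by ring
      _ ≤ (m + 1) * (m + 1) ^ (k + 1) := Nat.mul_le_mul_left _ ih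
      _ = (m + 1) ^ (k + 1 + 1) := by ring

/-- `2·m^(m+1) ≤ (m+1)^(m+1)`. [folklore] -/
theorem two_mul_pow_le (m : ℕ) : 2 * m ^ (m + 1) ≤ (m + 1) ^ (m + 1) := by
  calc 2 * m ^ (m + 1) = m ^ (m + 1) + m * m ^ m := by rw [two_mul, pow_succ]; ring
    _ ≤ m ^ (m + 1) + (m + 1) * m ^ m := Nat.add_le_add_left (Nat.mul_le_mul_right _ (Nat.le_succ m)) _
    _ ≤ (m + 1) ^ (m + 1) := pow_add_mul_pow_le m m

/-- `2^k · m^((m+1) k) ≤ (m+1)^((m+1) k)`. [folklore] -/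
theorem two_pow_mul_pow_le (m : ℕ) : ∀ k : ℕ, 2 ^ k * m ^ ((m + 1) * k) ≤ (m + 1) ^ ((m + 1) * k) := by
  intro k
  induction k with
  | zero => simp
  | succ k ih =>
    calc 2 ^ (k + 1) * m ^ ((m + 1) * (k + 1))
        = (2 ^ k * m ^ ((m + 1) * k)) * (2 * m ^ (m + 1)) := by rw [Nat.mul_succ, pow_add, pow_succ]; ring
      _ ≤ (m + 1) ^ ((m + 1) * k) * (m + 1) ^ (m + 1) := Nat.mul_le_mul ih (two_mul_pow_le m)
      _ = (m + 1) ^ ((m + 1) * (k + 1)) := by rw [← pow_add, Nat.mul_succ]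

/-- Linear versus exponential. [folklore] -/
theorem exists_lt_two_pow (a b : ℕ) : ∃ t, 7 ≤ t ∧ a * t + b < 2 ^ t := by
  have key : ∀ t : ℕ, 4 ≤ t → t * t ≤ 2 ^ t := by
    intro t ht
    induction t, ht using Nat.le_induction with
    | base => norm_num
    | succ t ht ih =>
      have h2 : 2 * t + 1 ≤ 2 ^ t := by
        have : 2 * t + 1 ≤ t * t := by nlinarith
        exact this.trans ih
      calc (t + 1) * (t + 1) = t * t + (2 * t + 1) := by ring
        _ ≤ 2 ^ t + 2 ^ t := Nat.add_le_add ih h2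
        _ = 2 ^ (t + 1) := by rw [pow_succ]; ring
  refine ⟨a + b + 7, by omega, ?_⟩
  have ht : 4 ≤ a + b + 7 := by omega
  calc a * (a + b + 7) + b < (a + b + 7) * (a + b + 7) := by nlinarith
    _ ≤ 2 ^ (a + b + 7) := key _ ht

/-! ## The main corollary -/

/-- `Tfib = (Tfib - 1) + 1` with `Tfib - 1` abstracted. [folklore] -/
theorem Tfib_eq : Tfib = (Tfib - 1) + 1 := (Nat.sub_add_cancel (Nat.one_le_pow _ _ (by norm_num))).symm

/-- The fibre constant `6^44` is below `2^114`. [folklore] -/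
theorem Tfib_lt : Tfib < 2 ^ 114 := by unfold Tfib; norm_num

/-- From the lower bound: for `n = 2^m`, `m ≥ 6`, a quasi-polynomial upper bound with constant `c` forces
`2^m ≤ 24·T·((m+c)^c + 4m + 6) + 60`. [folklore] -/
theorem key_ineq {c : ℕ} (H : ∀ n, complexity (triPM n) ≤ bound c n) {m : ℕ} (hm : 6 ≤ m) :
    2 ^ m ≤ 24 * Tfib * ((m + c) ^ c + 4 * m + 6) + 60 := by
  -- abstract the constant: T = M + 1
  set M := Tfib - 1 with hM
  have hT : Tfib = M + 1 := Tfib_eq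
  set n := 2 ^ m with hn
  have h64 : 64 ≤ n := by
    calc 64 = 2 ^ 6 := by norm_num
      _ ≤ 2 ^ m := Nat.pow_le_pow_right (by norm_num) hm
  have he : Even n := (Nat.even_pow.2 ⟨even_two, by omega⟩)
  -- k blocks of T gadgets
  set k := (n - 60) / (24 * Tfib) with hk
  have hTpos : 0 < 24 * Tfib := by rw [hT]; omega
  have hL : 24 * (Tfib * k) + 60 ≤ n := by
    have h1 : k * (24 * Tfib) ≤ n - 60 := Nat.div_mul_le_self _ _
    have h2 : 24 * (Tfib * k) = k * (24 * Tfib) := by ring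
    omega
  have hmain := monotone_lower_bound h64 he hL
  have hpow := two_pow_mul_pow_le M k
  rw [← hT] at hpow
  -- 2^k ≤ 4 s (n²+1)²
  have h2k : 2 ^ k ≤ 4 * complexity (triPM n) * (n * n + 1) ^ 2 := by
    have hposT : 0 < M ^ (Tfib * k) := Nat.pow_pos (by rw [hM]; unfold Tfib; norm_num)
    have : 2 ^ k * M ^ (Tfib * k) ≤ (4 * complexity (triPM n) * (n * n + 1) ^ 2) * M ^ (Tfib * k) :=
      hpow.trans hmain
    exact Nat.le_of_mul_le_mul_right this hposT
  -- bound the right-hand side by a power of two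
  have hlog : Nat.log 2 n = m := by rw [hn, Nat.log_pow (by norm_num)]
  have hsb : complexity (triPM n) ≤ 2 ^ ((m + c) ^ c) := by
    have := H n; unfold bound at this; rw [hlog] at this; exact this
  have hn2 : n * n + 1 ≤ 2 ^ (2 * m + 1) := by
    have : n * n = 2 ^ (2 * m) := by rw [hn, ← pow_add]; ring_nf
    rw [this, pow_succ]
    have : 1 ≤ 2 ^ (2 * m) := Nat.one_le_two_pow
    omega
  have hrhs : 4 * complexity (triPM n) * (n * n + 1) ^ 2 ≤ 2 ^ ((m + c) ^ c + 4 * m + 4) := by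
    calc 4 * complexity (triPM n) * (n * n + 1) ^ 2
        ≤ 4 * 2 ^ ((m + c) ^ c) * (2 ^ (2 * m + 1)) ^ 2 :=
          Nat.mul_le_mul (Nat.mul_le_mul_left _ hsb) (Nat.pow_le_pow_left hn2 2)
      _ = 2 ^ ((m + c) ^ c + 4 * m + 4) := by
          rw [← pow_mul, show (4 : ℕ) = 2 ^ 2 from rfl, ← pow_add, ← pow_add]; ring_nf
  have hkle : k ≤ (m + c) ^ c + 4 * m + 4 :=
    (Nat.pow_le_pow_iff_right (by norm_num)).1 (h2k.trans hrhs)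
  -- unfold k
  have hdiv : n - 60 < k * (24 * Tfib) + 24 * Tfib := by
    have := Nat.lt_div_mul_add (a := n - 60) hTpos
    rw [← hk] at this; exact this
  have h7 : n ≤ 24 * Tfib * (k + 1) + 60 := by
    have : 24 * Tfib * (k + 1) = k * (24 * Tfib) + 24 * Tfib := by ring
    omega
  calc 2 ^ m = n := rfl
    _ ≤ 24 * Tfib * (k + 1) + 60 := h7
    _ ≤ 24 * Tfib * ((m + c) ^ c + 4 * m + 6) + 60 := by
        apply Nat.add_le_add_right
        apply Nat.mul_le_mul_left
        omega

/-- **The crux is false without the division** (Valiant 1980, Thm 1, for the rhombus, in the tree's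
encoding): `D_n` does NOT have quasi-polynomial monotone complexity. [cite: Valiant1980, §3 Thm 1] -/
theorem not_monotoneEasyWithoutDivision : ¬ ∃ c : ℕ, ∀ n : ℕ, complexity (triPM n) ≤ bound c n := by
  rintro ⟨c, H⟩
  -- choose m = 2^t with (c+1) t + (c² + 124) < 2^t
  obtain ⟨t, ht7, ht⟩ := exists_lt_two_pow (c + 1) (c * c + 124)
  set m := 2 ^ t with hm
  have hm6 : 6 ≤ m := by
    calc 6 ≤ 2 ^ 7 := by norm_num
      _ ≤ 2 ^ t := Nat.pow_le_pow_right (by norm_num) ht7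
  have hkey := key_ineq H hm6
  -- bound the right-hand side of `hkey` by 2^(E t), E t = t c + c² + t + 124 < 2^t = m
  have h1 : (m + c) ^ c ≤ 2 ^ (t * c + c * c) := by
    have hc1 : m + c ≤ 2 ^ t * 2 ^ c := by
      have h1 : c < 2 ^ c := Nat.lt_two_pow_self
      have h2 : 1 ≤ 2 ^ c := Nat.one_le_two_pow
      have h3 : 1 ≤ 2 ^ t := Nat.one_le_two_pow
      rw [hm]; nlinarith
    calc (m + c) ^ c ≤ (2 ^ t * 2 ^ c) ^ c := Nat.pow_le_pow_left hc1 c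
      _ = 2 ^ (t * c + c * c) := by rw [← pow_add, ← pow_mul]; ring_nf
  have h2 : 4 * m + 6 ≤ 2 ^ (t + 3) := by
    rw [hm, pow_add]
    have : 1 ≤ 2 ^ t := Nat.one_le_two_pow
    norm_num; omega
  have h3 : (m + c) ^ c + 4 * m + 6 ≤ 2 ^ (t * c + c * c + t + 4) := by
    calc (m + c) ^ c + 4 * m + 6 ≤ 2 ^ (t * c + c * c) + 2 ^ (t + 3) := by omega
      _ ≤ 2 ^ (t * c + c * c + t + 3) + 2 ^ (t * c + c * c + t + 3) :=
          Nat.add_le_add (Nat.pow_le_pow_right (by norm_num) (by omega))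
            (Nat.pow_le_pow_right (by norm_num) (by omega))
      _ = 2 ^ (t * c + c * c + t + 4) := by rw [← two_mul, ← pow_succ']
  have h4 : 24 * Tfib * ((m + c) ^ c + 4 * m + 6) + 60 ≤ 2 ^ (t * c + c * c + t + 124) := by
    have hT : 24 * Tfib ≤ 2 ^ 119 := by
      calc 24 * Tfib ≤ 2 ^ 5 * 2 ^ 114 := Nat.mul_le_mul (by norm_num) Tfib_lt.le
        _ = 2 ^ 119 := by rw [← pow_add]
    have hpos : 1 ≤ 2 ^ (t * c + c * c + t + 4) := Nat.one_le_two_pow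
    calc 24 * Tfib * ((m + c) ^ c + 4 * m + 6) + 60
        ≤ 2 ^ 119 * 2 ^ (t * c + c * c + t + 4) + 2 ^ 119 * 2 ^ (t * c + c * c + t + 4) := by
          apply Nat.add_le_add (Nat.mul_le_mul hT h3)
          calc 60 ≤ 2 ^ 119 := by norm_num
            _ = 2 ^ 119 * 1 := (mul_one _).symm
            _ ≤ 2 ^ 119 * 2 ^ (t * c + c * c + t + 4) := Nat.mul_le_mul_left _ hpos
      _ = 2 ^ (t * c + c * c + t + 124) := by rw [← two_mul, ← pow_add, ← pow_succ']; ring_nf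
  have h5 : t * c + c * c + t + 124 < 2 ^ t := by nlinarith
  have h6 : 2 ^ (t * c + c * c + t + 124) < 2 ^ m := by
    rw [hm]; exact Nat.pow_lt_pow_right (by norm_num) h5
  exact absurd ((hkey.trans h4).trans_lt h6) (lt_irrefl _)

end

end Summit.ValiantsHypothesis.ValiantsHypothesis.Theorems.TriangularDimersDivisionEasy.Negative
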